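import Literature.Geometry.Kaehler.ComplexTorusHodgeLieAlgebraSymplecticDimension
import Literature.Geometry.Kaehler.ComplexTorusHodgeLieAlgebraCommutant
import Literature.Geometry.Kaehler.ComplexTorusUnitarySymplecticBasis
import Literature.Geometry.Kaehler.ComplexTorusLefschetzGroup
import Literature.Geometry.Kaehler.ComplexTorusHodgeGroupCenterFinite
import Literature.Geometry.Kaehler.ComplexTorusMumfordTateGroupCenter
import Literature.Geometry.Kaehler.ComplexTorusSimpleIffEndomorphismAlgebra
import Literature.Geometry.Kaehler.ComplexTorusHodgeLieAlgebraNoTypeFourSemisimple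
import HarnessLib

/-!
# A Hodge-general complex torus has `End_ℚ(X) = ℚ`: `Hg(X) = Sp(V, E) ⟹ End_ℚ(X) = ℚ`, `Lf(X) = Sp(V, E)`, no CM

[cite: Lange2023AbelianVarietiesComplex, §7.2.2 Prop. 7.2.5 ("`End_ℚ(X) ≃ End(V)^{Hg(X)}`") and §7.3.1 Prop. 7.3.2, proof of Prop. 7.3.3 ("`V_ℂ^* = H¹(X, ℂ)` is the standard representation of `Hg(X)(ℂ) = Sp(V, E)(ℂ) ≃ Sp_{2g}(ℂ)`")]
[cite: FultonHarris1991, §17.2 Theorem 17.5 (`k = 1`: the standard representation `V = V^{(1)}` of `𝔰𝔭_{2n}ℂ` is irreducible)]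
[cite: McDuffSalamon2017, §1.1 Lemma 1.1.12 ("`𝔰𝔭(2n) = {-J₀S | Sᵀ = S}`")]

For a complex torus `X = V/Λ` with a Riemann form `E`, "`End_ℚ(X) ≃ End(V)^{Hg(X)}`, where `Hg(X)` acts on
`End(V)` by conjugation" (Lange Prop. 7.2.5; in the tree in Lie-algebra form as
`forall_hodgeGroupLie_comm_iff_mem_span_endAlgRat`: the real commutant of `𝔥𝔤_ℝ` is `End_ℚ(X) ⊗ ℝ`). If `X` is
HODGE-GENERAL, `Hg(X) = Sp(V, E)` (Lange Prop. 7.3.2: the general member of every polarised family), then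
`𝔥𝔤_ℝ = 𝔰𝔭(V, E)` and the commutant is computed by Schur's lemma for the (absolutely) irreducible standard
representation of `𝔰𝔭_{2g}` (Fulton–Harris Thm. 17.5): it consists of the scalars. Hence **`End_ℚ(X) = ℚ`**, and with
it everything the tree derives from `endAlgRat Φ = ⊥`.

## What is proved (0 definitions, 0 named facts, no `sorry`)

§0 (linear algebra over a field `K` of characteristic `0`): the block form of the model symplectic algebra,
`[[A, B], [C, D]] ∈ 𝔰𝔭_{J₀} ⟺ D = -ᵗA ∧ ᵗB = B ∧ ᵗC = C` for `J₀ = Matrix.J n K` (`fromBlocks_mem_skewAdjoint_J_iff`;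
McDuff–Salamon Lemma 1.1.12), and **Schur for `𝔰𝔭_{J₀}`: a matrix commuting with every element of `𝔰𝔭_{J₀}` is a
scalar** (`exists_eq_smul_one_of_forall_skewAdjoint_J_comm`; test matrices `[[1,0],[0,-1]]`, `[[E_{ij},0],[0,-E_{ji}]]`,
`[[0,1],[0,0]]`).

§1 (polarised torus): **the commutant of `𝔰𝔭(V, E)` in `End(V_ℝ)` is `ℝ`**
(`IsRiemannForm.exists_eq_smul_one_of_forall_skewAdjoint_latticeGram_comm`; transport to the model by Lange's adapted
symplectic basis, Lemma 7.3.7 — `IsRiemannForm.exists_adaptedSymplecticBasis`).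

§2 (Hodge-general tori, `h : hodgeGroup Φ = spGroup Φ η`): the commutant of `𝔥𝔤_ℝ` is `ℝ`
(`IsRiemannForm.exists_eq_smul_one_of_forall_hodgeGroupLie_comm`); **`End_ℚ(X) = ℚ`**
(`IsRiemannForm.endAlgRat_eq_bot_of_hodgeGroup_eq_spGroup`); hence, by the tree: `Z(End_ℚ(X)) = ℚ`
(`IsRiemannForm.center_endAlgRat_eq_bot_of_hodgeGroup_eq_spGroup`), the Lefschetz group is everything,
**`Lf(X) = Sp(V, E') for every form `E'`, in particular `Lf(X) = Hg(X)`** (`IsRiemannForm.lefschetzGroup_eq_spGroup_of_hodgeGroup_eq_spGroup`,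
`IsRiemannForm.lefschetzGroup_eq_hodgeGroup_of_hodgeGroup_eq_spGroup`), the centre of `Hg(X)(ℂ)` is finite
(`IsRiemannForm.finite_center_hodgeGroupC_of_hodgeGroup_eq_spGroup`), the centre of `𝔥𝔤_ℝ` is `0`
(`IsRiemannForm.eq_zero_of_forall_hodgeGroupLie_comm_of_hodgeGroup_eq_spGroup`), `𝔤 = Lie(Hg(X)(ℂ))` is semisimple
(`IsRiemannForm.isSemisimple_hodgeGroupComplexLie_of_hodgeGroup_eq_spGroup`), **`X` is SIMPLE** (a polarised torus
with `End_ℚ(X) = ℚ` has only the idempotents `0, 1`: `IsRiemannForm.isSimple_of_endAlgRat_eq_bot`,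
`IsRiemannForm.isSimple_of_hodgeGroup_eq_spGroup`; Lange Thm. 2.4.19 / Cor. 2.4.26 through the tree's
`IsRiemannForm.isSimple_iff_forall_isIdempotentElem`), and **a Hodge-general torus of positive dimension is not of
CM-type** (`IsRiemannForm.not_exists_comm_isReduced_le_endAlgRat_of_hodgeGroup_eq_spGroup`: no commutative semisimple
`T ⊆ End_ℚ(X) = ℚ` of dimension `2g ≥ 2`; Lange Prop. 7.2.6 (ii)).

NOT here: the converse fails (`End_ℚ(X) = ℚ` does not force `Hg(X) = Sp(V, E)` — Mumford's fourfolds; not formalised);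
`NS(X) ≅ ℤ` (in the tree: `IsRiemannForm.finrank_hodgeClasses_eq_one_of_spGroup_le`).
-/

noncomputable section

open scoped Matrix

open Set Function Matrix Module

namespace Literature.Geometry.Kaehler

namespace ComplexTorus

/-! ## §0 The model: block form of `𝔰𝔭_{J₀}` and Schur's lemma for its standard representation -/

section LinearAlgebra

variable {K : Type*} [Field K] {m κ : Type*} [Fintype m] [DecidableEq m] [Fintype κ] [DecidableEq κ]
  {n : Type*} [Fintype n] [DecidableEq n]

/-- **`𝔰𝔭(2n)` in block form**: `[[A, B], [C, D]]` is skew-adjoint for `J₀ = [[0, -1], [1, 0]]` iff `D = -ᵗA`, `ᵗB = B`,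
`ᵗC = C`. [cite: McDuffSalamon2017, §1.1 Lemma 1.1.12 and Exercise 1.1.13] [cite: BrockerTomDieck1985, I (2.19)] -/
theorem fromBlocks_mem_skewAdjoint_J_iff (A B C D : Matrix n n K) :
    Matrix.fromBlocks A B C D ∈ skewAdjointMatricesSubmodule (Matrix.J n K) ↔ D = -Aᵀ ∧ Bᵀ = B ∧ Cᵀ = C := by
  rw [mem_skewAdjointMatricesSubmodule_iff_transpose_mul_add_mul_eq_zero, Matrix.J, Matrix.fromBlocks_transpose,
    Matrix.fromBlocks_multiply, Matrix.fromBlocks_multiply, Matrix.fromBlocks_add]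
  simp only [Matrix.mul_zero, Matrix.zero_mul, Matrix.mul_one, Matrix.one_mul, Matrix.mul_neg, Matrix.neg_mul,
    zero_add, add_zero]
  rw [← Matrix.fromBlocks_zero, Matrix.fromBlocks_inj]
  constructor
  · rintro ⟨h1, h2, -, h4⟩
    refine ⟨?_, neg_add_eq_zero.1 h4, add_neg_eq_zero.1 h1⟩
    rwa [← neg_add, neg_eq_zero, add_comm, add_eq_zero_iff_eq_neg] at h2
  · rintro ⟨rfl, hB, hC⟩
    simp [Matrix.transpose_neg, hB, hC]

omit [Fintype m] [DecidableEq m] [Fintype κ] [DecidableEq κ] in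
/-- A matrix equal to its own negative vanishes (characteristic `0`). [folklore] -/
private theorem eq_zero_of_eq_neg_self [CharZero K] {M : Matrix m κ K} (h : M = -M) : M = 0 :=
  Matrix.ext fun i j ↦ CharZero.eq_neg_self_iff.1 (by
    have h' := congr_fun (congr_fun h i) j
    rwa [Matrix.neg_apply] at h')

/-- **SCHUR FOR THE STANDARD REPRESENTATION OF `𝔰𝔭_{2n}`**: a `2n × 2n` matrix commuting with every element of
`𝔰𝔭_{J₀} = {[[A, B], [C, -ᵗA]] | ᵗB = B, ᵗC = C}` is a scalar (characteristic `0`). Test elements: `[[1,0],[0,-1]]`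
kills the off-diagonal blocks, `[[E_{ij},0],[0,-E_{ji}]]` makes the diagonal blocks scalar, `[[0,1],[0,0]]` equates them.
[cite: FultonHarris1991, §17.2 Theorem 17.5 (`k = 1`: "`V^{(k)}` … irreducible"; the standard representation `V = V^{(1)}`)]
[cite: Lange2023AbelianVarietiesComplex, §7.3.1, proof of Prop. 7.3.3 ("the standard representation of … `Sp_{2g}(ℂ)`")] -/
theorem exists_eq_smul_one_of_forall_skewAdjoint_J_comm [CharZero K] {Y : Matrix (n ⊕ n) (n ⊕ n) K}
    (hY : ∀ X ∈ skewAdjointMatricesSubmodule (Matrix.J n K), X * Y = Y * X) :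
    ∃ c : K, Y = c • (1 : Matrix (n ⊕ n) (n ⊕ n) K) := by
  obtain ⟨Y₁, Y₂, Y₃, Y₄, rfl⟩ : ∃ Y₁ Y₂ Y₃ Y₄ : Matrix n n K, Y = Matrix.fromBlocks Y₁ Y₂ Y₃ Y₄ :=
    ⟨_, _, _, _, (Matrix.fromBlocks_toBlocks Y).symm⟩
  have mem : ∀ A B C : Matrix n n K, Bᵀ = B → Cᵀ = C →
      Matrix.fromBlocks A B C (-Aᵀ) ∈ skewAdjointMatricesSubmodule (Matrix.J n K) := fun A B C hB hC ↦
    (fromBlocks_mem_skewAdjoint_J_iff _ _ _ _).2 ⟨rfl, hB, hC⟩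
  have key : ∀ A B C : Matrix n n K, Bᵀ = B → Cᵀ = C →
      A * Y₁ + B * Y₃ = Y₁ * A + Y₂ * C ∧ A * Y₂ + B * Y₄ = Y₁ * B + -(Y₂ * Aᵀ) ∧
        C * Y₁ + -(Aᵀ * Y₃) = Y₃ * A + Y₄ * C ∧ C * Y₂ + -(Aᵀ * Y₄) = Y₃ * B + -(Y₄ * Aᵀ) := by
    intro A B C hB hC
    have h := hY _ (mem A B C hB hC)
    rw [Matrix.fromBlocks_multiply, Matrix.fromBlocks_multiply, Matrix.fromBlocks_inj] at h
    simpa only [Matrix.neg_mul, Matrix.mul_neg] using h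
  -- (1) `[[1,0],[0,-1]]`: `Y₂ = 0 = Y₃`
  obtain ⟨-, h12, h13, -⟩ := key 1 0 0 Matrix.transpose_zero Matrix.transpose_zero
  simp only [Matrix.one_mul, Matrix.zero_mul, add_zero, Matrix.mul_zero, Matrix.transpose_one, Matrix.mul_one,
    zero_add] at h12 h13
  have hY₂ : Y₂ = 0 := eq_zero_of_eq_neg_self h12
  have hY₃ : Y₃ = 0 := eq_zero_of_eq_neg_self h13.symm
  -- (2) `[[E_{ij},0],[0,-E_{ji}]]`: `Y₁` is a scalar
  have hY₁ : Y₁ ∈ Set.range (Matrix.scalar n) := by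
    refine Matrix.mem_range_scalar_iff_commute_single'.2 fun i j ↦ ?_
    obtain ⟨h, -, -, -⟩ := key (Matrix.single i j 1) 0 0 Matrix.transpose_zero Matrix.transpose_zero
    rw [Matrix.zero_mul, add_zero, hY₂, Matrix.zero_mul, add_zero] at h
    exact h
  obtain ⟨c, hc⟩ := hY₁
  -- (3) `[[0,1],[0,0]]`: `Y₄ = Y₁`
  obtain ⟨-, h3, -, -⟩ := key 0 1 0 Matrix.transpose_one Matrix.transpose_zero
  rw [Matrix.zero_mul, zero_add, Matrix.one_mul, Matrix.mul_one, Matrix.transpose_zero, Matrix.mul_zero, neg_zero,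
    add_zero] at h3
  refine ⟨c, ?_⟩
  rw [hY₂, hY₃, h3, ← hc, Matrix.scalar_apply, ← Matrix.smul_one_eq_diagonal, ← Matrix.fromBlocks_one,
    Matrix.fromBlocks_smul, smul_zero]

/-- Transport of skew-adjointness under `X ↦ QXP` with `PQ = 1` (a private copy of the plumbing of
`ComplexTorusHodgeLieAlgebraSiegelDimension`). [folklore] -/
private theorem conj_mem_skewAdjoint_aux {P : Matrix m κ K} {Q : Matrix κ m K} (hPQ : P * Q = 1)
    {G X : Matrix m m K} (hX : X ∈ skewAdjointMatricesSubmodule G) :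
    Q * X * P ∈ skewAdjointMatricesSubmodule (Pᵀ * G * P) := by
  rw [mem_skewAdjointMatricesSubmodule_iff_transpose_mul_add_mul_eq_zero] at hX ⊢
  have hT : Qᵀ * Pᵀ = 1 := by rw [← Matrix.transpose_mul, hPQ, Matrix.transpose_one]
  calc (Q * X * P)ᵀ * (Pᵀ * G * P) + Pᵀ * G * P * (Q * X * P)
      = Pᵀ * Xᵀ * (Qᵀ * Pᵀ) * G * P + Pᵀ * G * (P * Q) * X * P := by
        simp only [Matrix.transpose_mul, Matrix.mul_assoc]
    _ = Pᵀ * (Xᵀ * G + G * X) * P := by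
        rw [hT, hPQ]; simp only [Matrix.mul_one, Matrix.mul_add, Matrix.add_mul, Matrix.mul_assoc]
    _ = 0 := by rw [hX, Matrix.mul_zero, Matrix.zero_mul]

/-- `𝔰𝔭_{-G} = 𝔰𝔭_G`. [folklore] -/
private theorem skewAdjoint_neg_aux (G : Matrix m m K) :
    skewAdjointMatricesSubmodule (-G) = skewAdjointMatricesSubmodule G := by
  ext X
  rw [mem_skewAdjointMatricesSubmodule_iff_transpose_mul_add_mul_eq_zero,
    mem_skewAdjointMatricesSubmodule_iff_transpose_mul_add_mul_eq_zero, Matrix.mul_neg, Matrix.neg_mul, ← neg_add,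
    neg_eq_zero]

end LinearAlgebra

/-! ## §1 The commutant of `𝔰𝔭(V, E)` in `End(V_ℝ)` is `ℝ` -/

section Torus

variable {ι : Type*} [Fintype ι] [DecidableEq ι] {E : Type*} [NormedAddCommGroup E] [NormedSpace ℂ E]
  {Φ : (ι → ℝ) ≃L[ℝ] E} {η : E [⋀^Fin 2]→L[ℝ] ℝ}

/-- **The commutant of `𝔰𝔭(V, E)` is `ℝ · 1`** for every polarised complex torus: a real endomorphism of `V_ℝ = ℝ^ι`
commuting with every `X ∈ 𝔰𝔭(V, E) = {X | ᵗX G + G X = 0}` is a scalar (Schur for the standard representation,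
transported from the model `J₀` by an adapted symplectic basis `ᵗP G P = -J₀`, Lange Lemma 7.3.7).
[cite: Lange2023AbelianVarietiesComplex, §7.3.1, proof of Prop. 7.3.3 and §7.3.2 Lemma 7.3.7 (p. 338)]
[cite: FultonHarris1991, §17.2 Theorem 17.5] -/
theorem IsRiemannForm.exists_eq_smul_one_of_forall_skewAdjoint_latticeGram_comm [FiniteDimensional ℂ E]
    (hη : IsRiemannForm Φ η) {Y : Matrix ι ι ℝ}
    (hY : ∀ X ∈ skewAdjointMatricesSubmodule (latticeGram Φ η), X * Y = Y * X) :
    ∃ c : ℝ, Y = c • (1 : Matrix ι ι ℝ) := by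
  -- the adapted basis in matrix form: `QP = 1 = PQ`, `ᵗP G P = -J₀`
  obtain ⟨B, hB₁, -⟩ := hη.exists_adaptedSymplecticBasis
  let T : (Fin (finrank ℂ E) ⊕ Fin (finrank ℂ E) → ℝ) ≃ₗ[ℝ] (ι → ℝ) := B.toLinearEquiv.trans Φ.symm.toLinearEquiv
  let P : Matrix ι (Fin (finrank ℂ E) ⊕ Fin (finrank ℂ E)) ℝ :=
    LinearMap.toMatrix' (T : (Fin (finrank ℂ E) ⊕ Fin (finrank ℂ E) → ℝ) →ₗ[ℝ] (ι → ℝ))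
  let Q : Matrix (Fin (finrank ℂ E) ⊕ Fin (finrank ℂ E)) ι ℝ :=
    LinearMap.toMatrix' (T.symm : (ι → ℝ) →ₗ[ℝ] (Fin (finrank ℂ E) ⊕ Fin (finrank ℂ E) → ℝ))
  have hQP : Q * P = 1 := by
    simp only [P, Q]
    rw [← LinearMap.toMatrix'_comp, LinearEquiv.symm_comp, LinearMap.toMatrix'_id]
  have hPQ : P * Q = 1 := by
    simp only [P, Q]
    rw [← LinearMap.toMatrix'_comp, LinearEquiv.comp_symm, LinearMap.toMatrix'_id]
  have hPx : ∀ x, P *ᵥ x = Φ.symm (B x) := fun x ↦ by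
    simp only [P]
    rw [LinearMap.toMatrix'_mulVec, LinearEquiv.coe_coe]
    rfl
  have hG : Pᵀ * latticeGram Φ η * P = -Matrix.J (Fin (finrank ℂ E)) ℝ := by
    refine Matrix.toBilin'.injective (LinearMap.ext fun x ↦ LinearMap.ext fun y ↦ ?_)
    rw [Matrix.toBilin'_apply', Matrix.toBilin'_apply', ← Matrix.mulVec_mulVec, ← Matrix.mulVec_mulVec,
      Matrix.dotProduct_mulVec x Pᵀ, Matrix.vecMul_transpose, dotProduct_latticeGram_mulVec, hPx, hPx,
      Φ.apply_symm_apply, Φ.apply_symm_apply, hB₁, Matrix.neg_mulVec, dotProduct_neg]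
  have hG' : Qᵀ * Matrix.J (Fin (finrank ℂ E)) ℝ * Q = -latticeGram Φ η := by
    have hTr : Qᵀ * Pᵀ = 1 := by rw [← Matrix.transpose_mul, hPQ, Matrix.transpose_one]
    have h : Qᵀ * (Pᵀ * latticeGram Φ η * P) * Q = latticeGram Φ η := by
      calc Qᵀ * (Pᵀ * latticeGram Φ η * P) * Q = Qᵀ * Pᵀ * latticeGram Φ η * (P * Q) := by
            simp only [Matrix.mul_assoc]
        _ = latticeGram Φ η := by rw [hTr, hPQ, Matrix.one_mul, Matrix.mul_one]
    rw [hG, Matrix.mul_neg, Matrix.neg_mul] at h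
    rw [← h, neg_neg]
  -- `Y₀ := Q Y P` commutes with the model algebra
  have hY₀ : ∀ X₀ ∈ skewAdjointMatricesSubmodule (Matrix.J (Fin (finrank ℂ E)) ℝ),
      X₀ * (Q * Y * P) = Q * Y * P * X₀ := by
    intro X₀ hX₀
    have hX : P * X₀ * Q ∈ skewAdjointMatricesSubmodule (latticeGram Φ η) := by
      have h := conj_mem_skewAdjoint_aux hQP hX₀
      rwa [hG', skewAdjoint_neg_aux] at h
    have h := hY _ hX
    calc X₀ * (Q * Y * P) = Q * P * X₀ * (Q * Y * P) := by rw [hQP, Matrix.one_mul]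
      _ = Q * (P * X₀ * Q * Y) * P := by simp only [Matrix.mul_assoc]
      _ = Q * (Y * (P * X₀ * Q)) * P := by rw [h]
      _ = Q * Y * P * X₀ * (Q * P) := by simp only [Matrix.mul_assoc]
      _ = Q * Y * P * X₀ := by rw [hQP, Matrix.mul_one]
  obtain ⟨c, hc⟩ := exists_eq_smul_one_of_forall_skewAdjoint_J_comm hY₀
  refine ⟨c, ?_⟩
  calc Y = P * Q * Y * (P * Q) := by rw [hPQ, Matrix.one_mul, Matrix.mul_one]
    _ = P * (Q * Y * P) * Q := by simp only [Matrix.mul_assoc]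
    _ = c • (1 : Matrix ι ι ℝ) := by rw [hc, Matrix.mul_smul, Matrix.smul_mul, Matrix.mul_one, hPQ]

/-! ## §2 Hodge-general tori: `End_ℚ(X) = ℚ` and its consequences -/

/-- **The commutant of `𝔥𝔤_ℝ` of a Hodge-general torus is `ℝ`** (`Hg(X) = Sp(V, E) ⟹ 𝔥𝔤_ℝ = 𝔰𝔭(V, E)`, then §1).
[cite: Lange2023AbelianVarietiesComplex, §7.3.1 Prop. 7.3.2 and proof of Prop. 7.3.3] [cite: FultonHarris1991, §17.2 Theorem 17.5] -/
theorem IsRiemannForm.exists_eq_smul_one_of_forall_hodgeGroupLie_comm [FiniteDimensional ℂ E]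
    (hη : IsRiemannForm Φ η) (h : hodgeGroup Φ = spGroup Φ η) {Y : Matrix ι ι ℝ}
    (hY : ∀ X ∈ hodgeGroupLie Φ, X * Y = Y * X) : ∃ c : ℝ, Y = c • (1 : Matrix ι ι ℝ) := by
  have hset := (hη.hodgeGroup_eq_spGroup_iff_coe_hodgeGroupLie_eq).1 h
  refine hη.exists_eq_smul_one_of_forall_skewAdjoint_latticeGram_comm fun X hX ↦ hY X ?_
  have hX' : X ∈ (hodgeGroupLie Φ : Set (Matrix ι ι ℝ)) := by rw [hset]; exact hX
  exact hX'

/-- **`Hg(X) = Sp(V, E) ⟹ End_ℚ(X) = ℚ`**: a Hodge-general polarised complex torus has only the scalar rational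
endomorphisms — `End_ℚ(X) ≃ End(V)^{Hg(X)}` (Lange Prop. 7.2.5; the tree's `forall_hodgeGroupLie_comm_of_mem_span_endAlgRat`)
and `End(V)^{Sp(V,E)} = ℚ` by Schur. [cite: Lange2023AbelianVarietiesComplex, §7.2.2 Prop. 7.2.5 and §7.3.1, proof of Prop. 7.3.3]
[cite: FultonHarris1991, §17.2 Theorem 17.5] -/
theorem IsRiemannForm.endAlgRat_eq_bot_of_hodgeGroup_eq_spGroup [FiniteDimensional ℂ E] (hη : IsRiemannForm Φ η)
    (h : hodgeGroup Φ = spGroup Φ η) : endAlgRat Φ = ⊥ := by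
  refine eq_bot_iff.2 fun M hM ↦ ?_
  have hcomm : ∀ X ∈ hodgeGroupLie Φ, X * M.map Rat.cast = M.map Rat.cast * X := fun X hX ↦
    forall_hodgeGroupLie_comm_of_mem_span_endAlgRat Φ (Submodule.subset_span ⟨M, hM, rfl⟩) hX
  obtain ⟨c, hc⟩ := hη.exists_eq_smul_one_of_forall_hodgeGroupLie_comm h hcomm
  rcases isEmpty_or_nonempty ι with hι | ⟨⟨i⟩⟩
  · rw [Subsingleton.elim M 0]
    exact (⊥ : Subalgebra ℚ (Matrix ι ι ℚ)).zero_mem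
  · have hc' : ∀ j k, ((M j k : ℚ) : ℝ) = c * (1 : Matrix ι ι ℝ) j k := fun j k ↦ by
      have h' := congr_fun (congr_fun hc j) k
      rwa [Matrix.map_apply, Matrix.smul_apply, smul_eq_mul] at h'
    have hci : ((M i i : ℚ) : ℝ) = c := by rw [hc' i i, Matrix.one_apply_eq, mul_one]
    have hq : M = algebraMap ℚ (Matrix ι ι ℚ) (M i i) := by
      ext j k
      apply Rat.cast_injective (α := ℝ)
      rw [hc' j k, ← hci, Matrix.algebraMap_matrix_apply, Algebra.algebraMap_self_apply]
      split_ifs with hjk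
      · rw [hjk, Matrix.one_apply_eq, mul_one]
      · rw [Matrix.one_apply_ne hjk, mul_zero, Rat.cast_zero]
    rw [hq]
    exact Subalgebra.algebraMap_mem _ _

/-- **`Hg(X) = Sp(V, E) ⟹ Z(End_ℚ(X)) = ℚ`.** [cite: Lange2023AbelianVarietiesComplex, §7.2.2 Prop. 7.2.5 and §7.3.1 Prop. 7.3.2] -/
theorem IsRiemannForm.center_endAlgRat_eq_bot_of_hodgeGroup_eq_spGroup [FiniteDimensional ℂ E]
    (hη : IsRiemannForm Φ η) (h : hodgeGroup Φ = spGroup Φ η) :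
    endAlgRat Φ ⊓ Subalgebra.centralizer ℚ (endAlgRat Φ : Set (Matrix ι ι ℚ)) = ⊥ :=
  center_endAlgRat_eq_bot_of_endAlgRat_eq_bot Φ (hη.endAlgRat_eq_bot_of_hodgeGroup_eq_spGroup h)

/-- **`Hg(X) = Sp(V, E) ⟹ Lf(X) = Sp(V, E')` for every real `2`-form `E'`**: with `End_ℚ(X) = ℚ` the Lefschetz group
(the centraliser of `End_ℚ(X)` in `Sp`) is the whole symplectic group. [cite: Lange2023AbelianVarietiesComplex, §7.2.2 Prop. 7.2.5 and §7.3.1 Prop. 7.3.2]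
[cite: Milne1999LefschetzClasses, §2 (the Lefschetz group as the centraliser of `End⁰(A)`)] -/
theorem IsRiemannForm.lefschetzGroup_eq_spGroup_of_hodgeGroup_eq_spGroup [FiniteDimensional ℂ E]
    (hη : IsRiemannForm Φ η) (h : hodgeGroup Φ = spGroup Φ η) (η' : E [⋀^Fin 2]→L[ℝ] ℝ) :
    lefschetzGroup Φ η' = spGroup Φ η' :=
  lefschetzGroup_eq_spGroup_of_endAlgRat_eq_bot Φ (hη.endAlgRat_eq_bot_of_hodgeGroup_eq_spGroup h) η'

/-- **`Hg(X) = Sp(V, E) ⟹ Lf(X) = Hg(X)`** (both equal `Sp(V, E)`): Hodge-general tori satisfy `Hg = Lf`.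
[cite: Lange2023AbelianVarietiesComplex, §7.3.1 Prop. 7.3.2] [cite: Milne1999LefschetzClasses, §2] -/
theorem IsRiemannForm.lefschetzGroup_eq_hodgeGroup_of_hodgeGroup_eq_spGroup [FiniteDimensional ℂ E]
    (hη : IsRiemannForm Φ η) (h : hodgeGroup Φ = spGroup Φ η) : lefschetzGroup Φ η = hodgeGroup Φ := by
  rw [hη.lefschetzGroup_eq_spGroup_of_hodgeGroup_eq_spGroup h, h]

/-- **`Hg(X) = Sp(V, E) ⟹` the centre of `Hg(X)(ℂ)` is finite** (it is `{±1}` inside `Sp_{2g}(ℂ)`; here: finite, by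
the tree's `End_ℚ(X) = ℚ ⟹ Z(Hg(X)(ℂ))` finite). [cite: Lange2023AbelianVarietiesComplex, §7.3.1 Prop. 7.3.2 and §7.2.2 Prop. 7.2.5] -/
theorem IsRiemannForm.finite_center_hodgeGroupC_of_hodgeGroup_eq_spGroup [FiniteDimensional ℂ E]
    (hη : IsRiemannForm Φ η) (h : hodgeGroup Φ = spGroup Φ η) :
    ((hodgeGroupC Φ ⊓ Subgroup.centralizer (hodgeGroupC Φ : Set (Matrix.SpecialLinearGroup ι ℂ)) :
      Subgroup (Matrix.SpecialLinearGroup ι ℂ)) : Set (Matrix.SpecialLinearGroup ι ℂ)).Finite :=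
  hη.finite_center_hodgeGroupC_of_endAlgRat_eq_bot (hη.endAlgRat_eq_bot_of_hodgeGroup_eq_spGroup h)

/-- **`Hg(X) = Sp(V, E) ⟹ 𝔷(𝔥𝔤_ℝ) = 0`**: the Hodge Lie algebra of a Hodge-general torus has trivial centre
(`𝔰𝔭` is semisimple; here through `End_ℚ(X) = ℚ`). [cite: Lange2023AbelianVarietiesComplex, §7.3.1, proof of Prop. 7.3.2 ("`𝔰𝔭(V, E)` is simple")] -/
theorem IsRiemannForm.eq_zero_of_forall_hodgeGroupLie_comm_of_hodgeGroup_eq_spGroup [FiniteDimensional ℂ E]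
    (hη : IsRiemannForm Φ η) (h : hodgeGroup Φ = spGroup Φ η) {X : Matrix ι ι ℝ} (hX : X ∈ hodgeGroupLie Φ)
    (hc : ∀ Y ∈ hodgeGroupLie Φ, X * Y = Y * X) : X = 0 :=
  eq_zero_of_forall_hodgeGroupLie_comm_of_endAlgRat_eq_bot Φ (hη.endAlgRat_eq_bot_of_hodgeGroup_eq_spGroup h) hX hc

/-- **`End_ℚ(X) = ℚ ⟹ X` simple** (polarised torus): the only idempotents of `ℚ · 1` are `0` and `1` (`q² = q`).
[cite: Lange2023AbelianVarietiesComplex, §2.4.3 Thm. 2.4.19 and §2.4.4 Cor. 2.4.26] [cite: MumfordAV1970, §19 Thm. 1 and Cor. 2] -/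
theorem IsRiemannForm.isSimple_of_endAlgRat_eq_bot (hη : IsRiemannForm Φ η) (hE : endAlgRat Φ = ⊥) : IsSimple Φ := by
  refine hη.isSimple_iff_forall_isIdempotentElem.2 fun A hA hA2 ↦ ?_
  rw [hE, Algebra.mem_bot] at hA
  obtain ⟨q, rfl⟩ := hA
  rcases isEmpty_or_nonempty ι with hι | hι
  · exact Or.inl (Subsingleton.elim _ _)
  · have hq : q * q = q := (algebraMap ℚ (Matrix ι ι ℚ)).injective (by rwa [map_mul])
    have hq' : q * (q - 1) = 0 := by rw [mul_sub, mul_one, hq, sub_self]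
    rcases mul_eq_zero.1 hq' with h0 | h1
    · exact Or.inl (by rw [h0, map_zero])
    · exact Or.inr (by rw [sub_eq_zero.1 h1, map_one])

/-- **A Hodge-general polarised complex torus is simple** (`Hg(X) = Sp(V, E) ⟹ End_ℚ(X) = ℚ ⟹` no non-trivial
idempotents, i.e. no non-trivial abelian subvariety up to isogeny). [cite: Lange2023AbelianVarietiesComplex, §7.3.1 Prop. 7.3.2, §7.2.2 Prop. 7.2.5 and §2.4.4 Cor. 2.4.26] -/
theorem IsRiemannForm.isSimple_of_hodgeGroup_eq_spGroup [FiniteDimensional ℂ E] (hη : IsRiemannForm Φ η)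
    (h : hodgeGroup Φ = spGroup Φ η) : IsSimple Φ :=
  hη.isSimple_of_endAlgRat_eq_bot (hη.endAlgRat_eq_bot_of_hodgeGroup_eq_spGroup h)

/-- **`Hg(X) = Sp(V, E) ⟹ 𝔤 = Lie(Hg(X)(ℂ))` is semisimple** (it is `𝔰𝔭_{2g}(ℂ)`; here via `End_ℚ(X) = ℚ` and the
tree's `IsRiemannForm.isSemisimple_hodgeGroupComplexLie_of_endAlgRat_eq_bot`).
[cite: Lange2023AbelianVarietiesComplex, §7.3.1, proof of Prop. 7.3.2 ("`𝔰𝔭(V, E)` is simple")] [cite: MoonenZarhin1999LowDim, §1 (p. 2)] -/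
theorem IsRiemannForm.isSemisimple_hodgeGroupComplexLie_of_hodgeGroup_eq_spGroup [FiniteDimensional ℂ E]
    (hη : IsRiemannForm Φ η) (h : hodgeGroup Φ = spGroup Φ η) :
    LieAlgebra.IsSemisimple ℂ (hodgeGroupComplexLie Φ) :=
  hη.isSemisimple_hodgeGroupComplexLie_of_endAlgRat_eq_bot (hη.endAlgRat_eq_bot_of_hodgeGroup_eq_spGroup h)

/-- **A Hodge-general torus of positive dimension is not of CM-type**: `End_ℚ(X) = ℚ` contains no commutative
semisimple subalgebra of dimension `2g ≥ 2` (Lange's criterion 7.2.6 (ii) fails).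
[cite: Lange2023AbelianVarietiesComplex, §7.2.3 Prop. 7.2.6 ((i) "the Hodge group `Hg(X)` is commutative" ⟺ (ii) "`End_ℚ(X)` contains a commutative semisimple `ℚ`-algebra of dimension `2g`") and §7.3.1 Prop. 7.3.2] -/
theorem IsRiemannForm.not_exists_comm_isReduced_le_endAlgRat_of_hodgeGroup_eq_spGroup [Nonempty ι]
    [FiniteDimensional ℂ E] (hη : IsRiemannForm Φ η) (h : hodgeGroup Φ = spGroup Φ η) :
    ¬ ∃ T : Subalgebra ℚ (Matrix ι ι ℚ), T ≤ endAlgRat Φ ∧ IsReduced T ∧ (∀ a ∈ T, ∀ b ∈ T, a * b = b * a) ∧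
        finrank ℚ T = Fintype.card ι := by
  rintro ⟨T, hT, -, -, hfin⟩
  rw [hη.endAlgRat_eq_bot_of_hodgeGroup_eq_spGroup h, le_bot_iff] at hT
  rw [hT, Subalgebra.finrank_bot, card_eq_two_mul_finrank Φ] at hfin
  -- `1 = 2g` with `2g = |ι| ≥ 1`
  have hpos : 0 < Fintype.card ι := Fintype.card_pos
  rw [card_eq_two_mul_finrank Φ] at hpos
  omega

end Torus

end ComplexTorus

end Literature.Geometry.Kaehler
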